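import Literature.Topology.FourManifolds.TubeReparam
import Literature.Topology.FourManifolds.CircleDiffeotopyProofs
import Literature.Topology.FourManifolds.FibreStraightening
import HarnessLib

/-!
# Base moves of the tube of a circle surgery: slides and base reparametrisations of `𝕊¹ × ℝ³`

Generic four-manifold infrastructure for the uniqueness of surgery on a framed circle
(Gompf–Stipsicz, *4-Manifolds and Kirby Calculus*, §5.2; Kosinski, *Differential Manifolds*,
VI.1–2 and III.3: the surgered manifold only depends on the framed circle up to isotopy, in
particular not on the parametrisation of the circle nor on the tubular neighbourhood beyond its
framing class). `TubeReparam.lean` treats self-diffeomorphisms `G` of the model tube `𝕊¹ × ℝ³`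
that *fix the zero section* and are the identity far out (`TubeDiffeo`): `ν.Surgered ≅ (ν ∘ G).Surgered`.
Here we add the two kinds of moves in the *base* direction needed for the uniqueness of tubular
neighbourhoods of a circle:

* `Literature.Topology.FourManifolds.TubeSlide` — compactly supported diffeomorphisms `S` of
  `𝕊¹ × ℝ³` that may *move* the zero section (inside itself: `S (u, 0) = (ψ u, 0)`); the slid tube
  `ν.slide S ψ _ = ν ∘ S` is a tube of the reparametrised circle `c ∘ ψ`, the ambient
  diffeomorphism `ν ∘ S ∘ ν⁻¹ ∪ id` (`CircleNbhd.slideDiffeo`, the construction of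
  `CircleNbhd.twistDiffeo` verbatim) transports the surgery gluing, and
  **`ν.Surgered ≅ (ν ∘ S).Surgered`** (`CircleNbhd.nonempty_diffeomorph_surgered_slide`), resp.
  `IsCircleSurgery … c → IsCircleSurgery … (c ∘ ψ)` (`IsCircleSurgery.slide`);
* `Literature.Topology.FourManifolds.AmbientIsotopy.tubeSlide` — the slide `(u, w) ↦ (F_{b(w)} u, w)`
  of an ambient isotopy `F` of `𝕊¹` cut off by a bump `b` in the fibre (`b 0 = 1`, `b = 0` off the
  unit ball), with `S (u, 0) = (F₁ u, 0)`: reparametrising the core circle by a diffeomorphism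
  isotopic to the identity does not change the surgery;
* `Literature.Topology.FourManifolds.liftTubeDiffeo` — the `TubeDiffeo` `(u, w) ↦ (circleDescend (Φ w) u, w)`
  of a smooth family `w ↦ Φ w` of positive lifts (`IsPosLift`, lifts of degree-one
  diffeomorphisms of `𝕊¹`) with `Φ 0 = id` and `Φ w = id` for `‖w‖ ≥ r`; joint smoothness of the
  inverse family comes from the fibrewise inverse function theorem (`fibrewiseDiffeomorph` on
  `ℝ³ × ℝ`), smoothness in the point of the circle from `contMDiff_circleDescend_family`.

## References
* R. E. Gompf, A. I. Stipsicz, *4-Manifolds and Kirby Calculus*, GSM 20 (1999), §5.2. [GompfStipsiczGSM1999]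
* A. Kosinski, *Differential Manifolds* (1993), III.3 (uniqueness of tubular neighbourhoods),
  VI.1 (transport of gluings along diffeomorphisms of the pieces). [Kosinski1993]
* M. W. Hirsch, *Differential Topology* (1976), Ch. 8 §1 (extension of compactly supported
  diffeotopies by the identity), §3 (diffeotopies of `S¹`). [Hirsch1976]
-/

noncomputable section

open scoped Manifold ContDiff Topology Real
open Set Function Metric

namespace Literature.Topology.FourManifolds

universe u

/-- Local notation: `𝔼 n` is the model Euclidean space `EuclideanSpace ℝ (Fin n)`. -/
local notation "𝔼 " n:arg => EuclideanSpace ℝ (Fin n)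

/-- Local notation: `𝕊 n` is the unit sphere in `EuclideanSpace ℝ (Fin (n + 1))`. -/
local notation "𝕊 " n:arg => (Metric.sphere (0 : EuclideanSpace ℝ (Fin (n + 1))) 1 : Set _)

attribute [local instance] fact_finrank_euclideanSpace_two

/-! ### `C^∞` maps on products of vector spaces, for the product model -/

section ProdModel

variable {E F G : Type*} [NormedAddCommGroup E] [NormedSpace ℝ E] [NormedAddCommGroup F]
  [NormedSpace ℝ F] [NormedAddCommGroup G] [NormedSpace ℝ G] {n : WithTop ℕ∞}

/-- A `C^n` map on `E × F` is `C^n` for the product model `𝓘(ℝ, E).prod 𝓘(ℝ, F)`. [folklore] -/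
theorem contMDiff_prodModel_of_contDiff {f : E × F → G} (hf : ContDiff ℝ n f) :
    ContMDiff (𝓘(ℝ, E).prod 𝓘(ℝ, F)) 𝓘(ℝ, G) n f := by
  have h1 : ContMDiff (𝓘(ℝ, E).prod 𝓘(ℝ, F)) 𝓘(ℝ, E × F) n fun p : E × F ↦ (p.1, p.2) :=
    contMDiff_fst.prodMk_space contMDiff_snd
  exact hf.contMDiff.comp h1

/-- A map on `E × F` that is `C^n` for the product model is `C^n`. [folklore] -/
theorem contDiff_of_contMDiff_prodModel {f : E × F → G}
    (hf : ContMDiff (𝓘(ℝ, E).prod 𝓘(ℝ, F)) 𝓘(ℝ, G) n f) : ContDiff ℝ n f := by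
  have h1 : ContMDiff 𝓘(ℝ, E × F) (𝓘(ℝ, E).prod 𝓘(ℝ, F)) n fun p : E × F ↦ (p.1, p.2) :=
    contDiff_fst.contMDiff.prodMk contDiff_snd.contMDiff
  exact contMDiff_iff_contDiff.1 (hf.comp h1)

end ProdModel

/-! ### Families of induced maps of the circle -/

section Descend

variable {F : Type*} [NormedAddCommGroup F] [NormedSpace ℝ F]

/-- **Joint smoothness of a family of induced circle maps** parametrised by a normed space: if
`(w, θ) ↦ Φ w θ` is `C^∞` and every `Φ w` commutes with the deck translation `θ ↦ θ + 2π`, then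
`(u, w) ↦ circleDescend (Φ w) u` is `C^∞` on `𝕊¹ × F` (read through the angle `angA` off `ptA`
and through `angB` off `ptB`; cf. `contMDiff_uncurry_circleDescend` for a real parameter). [folklore] -/
theorem contMDiff_circleDescend_family {Φ : F → ℝ → ℝ}
    (hΦ : ∀ w θ, Φ w (θ + 2 * π) = Φ w θ + 2 * π)
    (hs : ContDiff ℝ ∞ fun q : F × ℝ ↦ Φ q.1 q.2) :
    ContMDiff ((𝓡 1).prod 𝓘(ℝ, F)) (𝓡 1) ∞ fun p : (𝕊 1) × F ↦ circleDescend (Φ p.2) p.1 := by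
  rintro ⟨u, w⟩
  have hg : ContDiff ℝ ∞ fun q : F × ℝ ↦ Φ q.1 (2 * π * q.2) :=
    hs.comp (contDiff_fst.prodMk (contDiff_const.mul contDiff_snd))
  by_cases hu : u = ptA
  · have hB : u ≠ ptB := hu ▸ ptA_ne_ptB
    have heq : (fun p : (𝕊 1) × F ↦ circleDescend (Φ p.2) p.1) = circlePoint ∘
        ((fun q : F × ℝ ↦ Φ q.1 (2 * π * q.2)) ∘ fun p : (𝕊 1) × F ↦ (p.2, angB p.1)) :=
      funext fun p ↦ circleDescend_eq_angB (hΦ p.2) p.1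
    rw [heq]
    refine contMDiff_circlePoint.contMDiffAt.comp (u, w) ?_
    refine hg.contDiffAt.comp_contMDiffAt ?_
    have h2 : ContMDiffAt ((𝓡 1).prod 𝓘(ℝ, F)) 𝓘(ℝ, ℝ) ∞ (angB ∘ Prod.fst) (u, w) :=
      (contMDiffAt_angB hB).comp (u, w) contMDiffAt_fst
    exact contMDiffAt_snd.prodMk_space h2
  · have heq : (fun p : (𝕊 1) × F ↦ circleDescend (Φ p.2) p.1) = circlePoint ∘
        ((fun q : F × ℝ ↦ Φ q.1 (2 * π * q.2)) ∘ fun p : (𝕊 1) × F ↦ (p.2, angA p.1)) := rfl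
    rw [heq]
    refine contMDiff_circlePoint.contMDiffAt.comp (u, w) ?_
    refine hg.contDiffAt.comp_contMDiffAt ?_
    have h2 : ContMDiffAt ((𝓡 1).prod 𝓘(ℝ, F)) 𝓘(ℝ, ℝ) ∞ (angA ∘ Prod.fst) (u, w) :=
      (contMDiffAt_angA hu).comp (u, w) contMDiffAt_fst
    exact contMDiffAt_snd.prodMk_space h2

end Descend

/-! ### Positive lifts as diffeomorphisms of the line -/

namespace IsPosLift

variable {Φ : ℝ → ℝ} (h : IsPosLift Φ)
include h

/-- A positive lift is bijective. [folklore] -/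
theorem bijective : Bijective Φ := ⟨h.injective, h.surjective⟩

/-- **A positive lift as a diffeomorphism of the line** (inverse `Φ⁻¹ = h.inv`). [folklore] -/
def lineDiffeomorph : ℝ ≃ₘ⟮𝓘(ℝ, ℝ), 𝓘(ℝ, ℝ)⟯ ℝ where
  toFun := Φ
  invFun := h.inv
  left_inv := h.inv_apply
  right_inv := h.apply_inv
  contMDiff_toFun := h.contDiff.contMDiff
  contMDiff_invFun := h.contDiff_inv.contMDiff

/-- The line diffeomorphism of a positive lift is the lift. [folklore] -/
@[simp] theorem coe_lineDiffeomorph : ⇑h.lineDiffeomorph = Φ := rfl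

/-- A positive lift is a local diffeomorphism of the line. [folklore] -/
theorem isLocalDiffeomorph : IsLocalDiffeomorph 𝓘(ℝ, ℝ) 𝓘(ℝ, ℝ) ∞ Φ :=
  h.lineDiffeomorph.isLocalDiffeomorph

end IsPosLift

/-! ### Compactly supported diffeomorphisms of `𝕊¹ × ℝ³` moving the zero section -/

/-- **A slide of the model tube**: a diffeomorphism `S` of `𝕊¹ × ℝ³` which is the identity on
`𝕊¹ × {‖w‖ ≥ radius}` (no condition on the zero section; when `S (u, 0) = (ψ u, 0)` the zero
section is reparametrised by `ψ`). Precomposing a tube with `S` is the isotopy move of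
Gompf–Stipsicz §5.2 for isotopies supported near the circle. [cite: GompfStipsiczGSM1999, §5.2] -/
structure TubeSlide where
  /-- The diffeomorphism of `𝕊¹ × ℝ³`. -/
  toDiffeomorph :
    ((𝕊 1) × 𝔼 3) ≃ₘ⟮(𝓡 1).prod 𝓘(ℝ, 𝔼 3), (𝓡 1).prod 𝓘(ℝ, 𝔼 3)⟯ ((𝕊 1) × 𝔼 3)
  /-- The radius outside which the diffeomorphism is the identity. -/
  radius : ℝ
  /-- Outside `𝕊¹ × B(0, radius)` the diffeomorphism is the identity. -/
  eq_self : ∀ p : (𝕊 1) × 𝔼 3, radius ≤ ‖p.2‖ → toDiffeomorph p = p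

namespace TubeSlide

/-- The inverse slide (same radius). [folklore] -/
def symm (S : TubeSlide) : TubeSlide where
  toDiffeomorph := S.toDiffeomorph.symm
  radius := S.radius
  eq_self p hp := S.toDiffeomorph.injective (by
    show S.toDiffeomorph (S.toDiffeomorph.symm p) = S.toDiffeomorph p
    rw [Diffeomorph.apply_symm_apply, S.eq_self p hp])

/-- `S.symm` undoes `S`. [folklore] -/
@[simp] theorem symm_apply_apply (S : TubeSlide) (p : (𝕊 1) × 𝔼 3) :
    S.symm.toDiffeomorph (S.toDiffeomorph p) = p :=
  S.toDiffeomorph.symm_apply_apply p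

/-- `S` undoes `S.symm`. [folklore] -/
@[simp] theorem apply_symm_apply (S : TubeSlide) (p : (𝕊 1) × 𝔼 3) :
    S.toDiffeomorph (S.symm.toDiffeomorph p) = p :=
  S.toDiffeomorph.apply_symm_apply p

/-- A point moved by `S` lies in `𝕊¹ × B(0, radius)`. [folklore] -/
theorem norm_lt_of_ne (S : TubeSlide) {p : (𝕊 1) × 𝔼 3} (hp : S.toDiffeomorph p ≠ p) :
    ‖p.2‖ < S.radius :=
  not_le.1 fun h ↦ hp (S.eq_self p h)

end TubeSlide

/-- A `TubeDiffeo` (fixing the zero section) is in particular a slide. [folklore] -/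
def TubeDiffeo.toTubeSlide (G : TubeDiffeo) : TubeSlide := ⟨G.toDiffeomorph, G.radius, G.eq_self⟩

/-- The identity reparametrisation of the model tube. [folklore] -/
def TubeDiffeo.refl : TubeDiffeo where
  toDiffeomorph := Diffeomorph.refl _ _ _
  radius := 0
  apply_zero _ := rfl
  eq_self _ _ := rfl

/-- The identity reparametrisation, pointwise. [folklore] -/
@[simp] theorem TubeDiffeo.refl_apply (p : (𝕊 1) × 𝔼 3) : TubeDiffeo.refl.toDiffeomorph p = p := rfl

/-- **The surgery only uses the unit ball bundle of the tube**: two tubes of the same circle that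
agree on `𝕊¹ × B(0, 1)` give diffeomorphic surgered manifolds. [cite: GompfStipsiczGSM1999, §5.2] -/
theorem CircleNbhd.nonempty_diffeomorph_surgered_of_eqOn {X : Type u} [TopologicalSpace X]
    [ChartedSpace (𝔼 4) X] [T2Space X] [IsManifold (𝓡 4) ∞ X] {c : 𝕊 1 → X}
    (ν ν' : CircleNbhd (𝓡 4) c)
    (h : ∀ (u : 𝕊 1) (w : 𝔼 3), ‖w‖ < 1 → ν'.toFun (u, w) = ν.toFun (u, w)) :
    Nonempty (ν.Surgered ≃ₘ⟮𝓡 4, 𝓡 4⟯ ν'.Surgered) :=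
  ν.nonempty_diffeomorph_surgered_of_eqOn_twist TubeDiffeo.refl ν' fun u w hw ↦ by
    rw [TubeDiffeo.refl_apply]; exact h u w hw

/-- The slide of a `TubeDiffeo`, pointwise (definitional). [folklore] -/
@[simp] theorem TubeDiffeo.toTubeSlide_apply (G : TubeDiffeo) (p : (𝕊 1) × 𝔼 3) :
    G.toTubeSlide.toDiffeomorph p = G.toDiffeomorph p := rfl

/-! ### The slid tube and the ambient diffeomorphism -/

namespace CircleNbhd

variable {X : Type u} [TopologicalSpace X] [ChartedSpace (𝔼 4) X] {c : 𝕊 1 → X}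
  (ν : CircleNbhd (𝓡 4) c) (S : TubeSlide)

/-- **The slid tube `ν ∘ S`**, a tubular neighbourhood of the reparametrised circle `c ∘ ψ` when
`S (u, 0) = (ψ u, 0)`. [cite: GompfStipsiczGSM1999, §5.2] -/
def slide (ψ : 𝕊 1 → 𝕊 1) (hψ : ∀ u, S.toDiffeomorph (u, 0) = (ψ u, 0)) :
    CircleNbhd (𝓡 4) (c ∘ ψ) where
  toFun := ν.toFun ∘ S.toDiffeomorph
  isSmoothEmbedding := ν.isSmoothEmbedding.comp_diffeomorph S.toDiffeomorph
  isOpen_range := by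
    have hs : Surjective (fun p ↦ S.toDiffeomorph p) := S.toDiffeomorph.surjective
    rw [Set.range_comp, hs.range_eq, image_univ]
    exact ν.isOpen_range
  apply_zero u := by
    simp only [Function.comp_apply, hψ u, ν.apply_zero]

/-- The slid tube, pointwise. [folklore] -/
@[simp] theorem slide_apply (ψ : 𝕊 1 → 𝕊 1) (hψ : ∀ u, S.toDiffeomorph (u, 0) = (ψ u, 0))
    (p : (𝕊 1) × 𝔼 3) : (ν.slide S ψ hψ).toFun p = ν.toFun (S.toDiffeomorph p) := rfl

open scoped Classical in
/-- The map `ν ∘ S ∘ ν⁻¹` on the range of `ν`, extended by the identity. [folklore] -/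
def slideFun (x : X) : X :=
  if x ∈ range ν.toFun then ν.toFun (S.toDiffeomorph (ν.toHomeo.symm x)) else x

/-- On the tube, `slideFun` is `ν ∘ S ∘ ν⁻¹`. [folklore] -/
theorem slideFun_apply_toFun (p : (𝕊 1) × 𝔼 3) :
    ν.slideFun S (ν.toFun p) = ν.toFun (S.toDiffeomorph p) := by
  rw [slideFun, if_pos (mem_range_self p), toHomeo_symm_apply]

/-- Off the tube, `slideFun` is the identity. [folklore] -/
theorem slideFun_of_not_mem {x : X} (hx : x ∉ range ν.toFun) : ν.slideFun S x = x := by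
  rw [slideFun, if_neg hx]

/-- `slideFun` is the identity off the image of `𝕊¹ × B(0, radius)`. [folklore] -/
theorem slideFun_eq_self {x : X} (hx : x ∉ ν.toFun '' {p | ‖p.2‖ < S.radius}) :
    ν.slideFun S x = x := by
  by_cases h : x ∈ range ν.toFun
  · obtain ⟨p, rfl⟩ := h
    rw [slideFun_apply_toFun]
    congr 1
    by_contra hne
    exact hx ⟨p, S.norm_lt_of_ne hne, rfl⟩
  · exact ν.slideFun_of_not_mem S h

/-- `slideFun` for `S.symm` undoes `slideFun` for `S`. [folklore] -/
theorem slideFun_symm_slideFun (x : X) : ν.slideFun S.symm (ν.slideFun S x) = x := by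
  by_cases h : x ∈ range ν.toFun
  · obtain ⟨p, rfl⟩ := h
    rw [slideFun_apply_toFun, slideFun_apply_toFun, TubeSlide.symm_apply_apply]
  · rw [ν.slideFun_of_not_mem S h, ν.slideFun_of_not_mem S.symm h]

/-- `slideFun` for `S` undoes `slideFun` for `S.symm`. [folklore] -/
theorem slideFun_slideFun_symm (x : X) : ν.slideFun S (ν.slideFun S.symm x) = x := by
  by_cases h : x ∈ range ν.toFun
  · obtain ⟨p, rfl⟩ := h
    rw [slideFun_apply_toFun, slideFun_apply_toFun, TubeSlide.apply_symm_apply]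
  · rw [ν.slideFun_of_not_mem S.symm h, ν.slideFun_of_not_mem S h]

variable [T2Space X]

/-- **`slideFun` is smooth.** On the open range of `ν` it is `ν ∘ S ∘ ν⁻¹`; off the compact set
`ν(𝕊¹ × B̄(0, radius))` it is the identity; the two open sets cover `X`. [folklore] -/
theorem contMDiff_slideFun : ContMDiff (𝓡 4) (𝓡 4) ∞ (ν.slideFun S) := by
  intro x
  by_cases hx : x ∈ range ν.toFun
  · have hnhds : range ν.toFun ∈ 𝓝 x := ν.isOpen_range.mem_nhds hx
    have heq : ν.slideFun S =ᶠ[𝓝 x] fun y ↦ ν.toFun (S.toDiffeomorph (ν.toHomeo.symm y)) := by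
      filter_upwards [hnhds] with y hy
      rw [slideFun, if_pos hy]
    refine ContMDiffAt.congr_of_eventuallyEq ?_ heq
    have h1 : ContMDiffAt (𝓡 4) ((𝓡 1).prod 𝓘(ℝ, 𝔼 3)) ∞ ν.toHomeo.symm x :=
      (ν.contMDiffOn_toHomeo_symm x hx).contMDiffAt hnhds
    exact (ν.contMDiff.comp S.toDiffeomorph.contMDiff).contMDiffAt.comp x h1
  · set K : Set X := ν.toFun '' (univ ×ˢ Metric.closedBall (0 : 𝔼 3) S.radius) with hK
    have hKc : IsCompact K :=
      (isCompact_univ.prod (isCompact_closedBall _ _)).image ν.continuous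
    have hxK : x ∉ K := by
      rintro ⟨p, -, rfl⟩
      exact hx (mem_range_self p)
    have hnhds : Kᶜ ∈ 𝓝 x := hKc.isClosed.isOpen_compl.mem_nhds hxK
    have heq : ν.slideFun S =ᶠ[𝓝 x] id := by
      filter_upwards [hnhds] with y hy
      apply ν.slideFun_eq_self S
      rintro ⟨p, hp, rfl⟩
      exact hy ⟨p, ⟨mem_univ _, Metric.mem_closedBall.2 (by simpa using hp.le)⟩, rfl⟩
    exact contMDiffAt_id.congr_of_eventuallyEq heq

/-- **The ambient diffeomorphism of a slide**: `ν ∘ S ∘ ν⁻¹` on the tube, the identity elsewhere,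
with inverse the same construction for `S⁻¹` (Hirsch, Ch. 8 §1: extension by the identity of a
compactly supported diffeomorphism of an open subset). [cite: Hirsch1976, Ch. 8 §1] -/
def slideDiffeo : X ≃ₘ⟮𝓡 4, 𝓡 4⟯ X where
  toFun := ν.slideFun S
  invFun := ν.slideFun S.symm
  left_inv := ν.slideFun_symm_slideFun S
  right_inv := ν.slideFun_slideFun_symm S
  contMDiff_toFun := ν.contMDiff_slideFun S
  contMDiff_invFun := ν.contMDiff_slideFun S.symm

/-- `slideDiffeo ν S ∘ ν = ν ∘ S`. [folklore] -/
@[simp] theorem slideDiffeo_apply_toFun (p : (𝕊 1) × 𝔼 3) :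
    ν.slideDiffeo S (ν.toFun p) = ν.toFun (S.toDiffeomorph p) :=
  ν.slideFun_apply_toFun S p

/-- The inverse: `(slideDiffeo ν S)⁻¹ ∘ ν = ν ∘ S⁻¹`. [folklore] -/
@[simp] theorem slideDiffeo_symm_apply_toFun (p : (𝕊 1) × 𝔼 3) :
    (ν.slideDiffeo S).symm (ν.toFun p) = ν.toFun (S.symm.toDiffeomorph p) :=
  ν.slideFun_apply_toFun S.symm p

/-- The ambient diffeomorphism maps the core circle to the reparametrised core circle:
`Ψ (c u) = c (ψ u)`. [folklore] -/
theorem slideDiffeo_apply_curve (ψ : 𝕊 1 → 𝕊 1) (hψ : ∀ u, S.toDiffeomorph (u, 0) = (ψ u, 0))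
    (u : 𝕊 1) : ν.slideDiffeo S (c u) = c (ψ u) := by
  rw [← ν.apply_zero u, slideDiffeo_apply_toFun, hψ, ν.apply_zero]

/-- `Ψ ∘ c = c ∘ ψ`. [folklore] -/
theorem slideDiffeo_comp_curve (ψ : 𝕊 1 → 𝕊 1) (hψ : ∀ u, S.toDiffeomorph (u, 0) = (ψ u, 0)) :
    ⇑(ν.slideDiffeo S) ∘ c = c ∘ ψ :=
  funext (ν.slideDiffeo_apply_curve S ψ hψ)

variable [IsManifold (𝓡 4) ∞ X] (ψ : 𝕊 1 → 𝕊 1) (hψ : ∀ u, S.toDiffeomorph (u, 0) = (ψ u, 0))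

/-- The ambient diffeomorphism restricted to the complements of the core circles
`(X ∖ c) ≅ (X ∖ c ∘ ψ)`. [folklore] -/
def slideComplement : ↥ν.complement ≃ₘ⟮𝓡 4, 𝓡 4⟯ ↥(ν.slide S ψ hψ).complement where
  toFun a := ⟨ν.slideDiffeo S a, by
    rintro ⟨u, hu⟩
    rw [Function.comp_apply, ← ν.slideDiffeo_apply_curve S ψ hψ u] at hu
    exact a.2 ⟨u, (ν.slideDiffeo S).injective hu⟩⟩
  invFun a := ⟨(ν.slideDiffeo S).symm a, by
    rintro ⟨u, hu⟩
    refine a.2 ⟨u, ?_⟩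
    rw [Function.comp_apply, ← ν.slideDiffeo_apply_curve S ψ hψ u, hu,
      Diffeomorph.apply_symm_apply]⟩
  left_inv a := Subtype.ext ((ν.slideDiffeo S).symm_apply_apply a)
  right_inv a := Subtype.ext ((ν.slideDiffeo S).apply_symm_apply a)
  contMDiff_toFun := by
    refine (ContMDiff.subtypeVal_comp_iff _ _).1 ?_
    exact (ν.slideDiffeo S).contMDiff.comp contMDiff_subtype_val
  contMDiff_invFun := by
    refine (ContMDiff.subtypeVal_comp_iff _ _).1 ?_
    exact (ν.slideDiffeo S).symm.contMDiff.comp contMDiff_subtype_val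

omit [IsManifold (𝓡 4) ∞ X] in
/-- The restricted inverse, pointwise. [folklore] -/
@[simp] theorem coe_slideComplement_symm_apply (a : ↥(ν.slide S ψ hψ).complement) :
    ((ν.slideComplement S ψ hψ).symm a : X) = (ν.slideDiffeo S).symm a := rfl

/-! ### Invariance of the surgery under slides -/

/-- **Transport of the surgery gluing along a slide.** If `P` is an open gluing of `X ∖ c` and
`D̊² × 𝕊²` along `circleSurgeryRel ν`, then — precomposing the embedding of `X ∖ c` with the
restriction of `(slideDiffeo ν S)⁻¹` — it is an open gluing of `X ∖ c ∘ ψ` and `D̊² × 𝕊²` along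
`circleSurgeryRel (ν ∘ S)` (Kosinski VI.1: transport of a gluing along a diffeomorphism of a
piece). [cite: Kosinski1993, Ch. VI §1 (transport of gluings)] -/
theorem isOpenGluing_slide_of_isOpenGluing {P : Type*} [TopologicalSpace P] [ChartedSpace (𝔼 4) P]
    (h : IsOpenGluing (𝓡 4) (𝓘(ℝ, 𝔼 2).prod (𝓡 2)) (𝓡 4) (A := ↥ν.complement) (B := ↥discTimesSphere)
      (P := P) (circleSurgeryRel ν)) :
    IsOpenGluing (𝓡 4) (𝓘(ℝ, 𝔼 2).prod (𝓡 2)) (𝓡 4) (A := ↥(ν.slide S ψ hψ).complement)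
      (B := ↥discTimesSphere) (P := P) (circleSurgeryRel (ν.slide S ψ hψ)) := by
  obtain ⟨jA, jB, hA, hAo, hB, hBo, hU, hR⟩ := h
  have hsurj : Surjective (fun a ↦ (ν.slideComplement S ψ hψ).symm a) :=
    fun a ↦ ⟨ν.slideComplement S ψ hψ a, (ν.slideComplement S ψ hψ).symm_apply_apply a⟩
  refine ⟨jA ∘ (ν.slideComplement S ψ hψ).symm, jB,
    hA.comp_diffeomorph (ν.slideComplement S ψ hψ).symm, ?_, hB, hBo, ?_, fun a b ↦ ?_⟩
  · show IsOpen (range (jA ∘ fun a ↦ (ν.slideComplement S ψ hψ).symm a))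
    rwa [hsurj.range_comp]
  · show range (jA ∘ fun a ↦ (ν.slideComplement S ψ hψ).symm a) ∪ range jB = univ
    rwa [hsurj.range_comp]
  · rw [Function.comp_apply, hR]
    simp only [circleSurgeryRel, coe_slideComplement_symm_apply, slide_apply]
    refine exists_congr fun u ↦ exists_congr fun t ↦ and_congr_right fun _ ↦
      and_congr_right fun _ ↦ ?_
    constructor
    · intro h1
      rw [← slideDiffeo_apply_toFun, ← h1, Diffeomorph.apply_symm_apply]
    · intro h1
      rw [h1, ← slideDiffeo_apply_toFun, Diffeomorph.symm_apply_apply]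

/-- **`ν.Surgered` is a surgery along the slid tube `ν ∘ S` of `c ∘ ψ`.** [cite: GompfStipsiczGSM1999, §5.2] -/
theorem isOpenGluing_surgered_slide :
    IsOpenGluing (𝓡 4) (𝓘(ℝ, 𝔼 2).prod (𝓡 2)) (𝓡 4) (A := ↥(ν.slide S ψ hψ).complement)
      (B := ↥discTimesSphere) (P := ν.Surgered) (circleSurgeryRel (ν.slide S ψ hψ)) :=
  ν.isOpenGluing_slide_of_isOpenGluing S ψ hψ ν.isOpenGluing_surgered

/-- **Sliding the tube does not change the surgery**: `ν.Surgered ≅ (ν ∘ S).Surgered`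
(uniqueness of open gluings). [cite: GompfStipsiczGSM1999, §5.2] -/
theorem nonempty_diffeomorph_surgered_slide :
    Nonempty (ν.Surgered ≃ₘ⟮𝓡 4, 𝓡 4⟯ (ν.slide S ψ hψ).Surgered) :=
  IsOpenGluing.nonempty_diffeomorph (ν.isOpenGluing_surgered_slide S ψ hψ)
    (ν.slide S ψ hψ).isOpenGluing_surgered

end CircleNbhd

/-- **Circle surgery is invariant under slides of the tube**: if `P` is obtained from `X` by
surgery on `c` (with some tube `ν`), it is obtained by surgery on the reparametrised circle
`c ∘ ψ` (with the tube `ν ∘ S`), for every slide `S` of the model tube with `S (u, 0) = (ψ u, 0)`. [cite: GompfStipsiczGSM1999, §5.2] -/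
theorem IsCircleSurgery.slide {X : Type u} [TopologicalSpace X] [ChartedSpace (𝔼 4) X] [T2Space X]
    [IsManifold (𝓡 4) ∞ X] {P : Type*} [TopologicalSpace P] [ChartedSpace (𝔼 4) P] {c : 𝕊 1 → X}
    (h : IsCircleSurgery (𝓡 4) (𝓡 4) X P c) (S : TubeSlide) (ψ : 𝕊 1 → 𝕊 1)
    (hψ : ∀ u, S.toDiffeomorph (u, 0) = (ψ u, 0)) : IsCircleSurgery (𝓡 4) (𝓡 4) X P (c ∘ ψ) := by
  obtain ⟨ν, hν⟩ := h
  exact ⟨ν.slide S ψ hψ, ν.isOpenGluing_slide_of_isOpenGluing S ψ hψ hν⟩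

/-! ### Slides from ambient isotopies of the circle -/

section Bump

/-- A fixed smooth bump on `ℝ³`: `1` on `B̄(0, 1/2)`, `0` off `B(0, 1)`. [folklore] -/
def unitBump : ContDiffBump (0 : 𝔼 3) := ⟨1 / 2, 1, by norm_num, by norm_num⟩

/-- The bump is `1` at the origin. [folklore] -/
@[simp] theorem unitBump_apply_zero : (unitBump : 𝔼 3 → ℝ) 0 = 1 :=
  unitBump.one_of_mem_closedBall (by simp [unitBump])

/-- The bump is `1` on `B̄(0, 1/2)`. [folklore] -/
theorem unitBump_of_norm_le_half {w : 𝔼 3} (hw : ‖w‖ ≤ 1 / 2) : (unitBump : 𝔼 3 → ℝ) w = 1 :=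
  unitBump.one_of_mem_closedBall (by simpa [unitBump] using hw)

/-- The bump vanishes off the unit ball. [folklore] -/
theorem unitBump_of_one_le {w : 𝔼 3} (hw : 1 ≤ ‖w‖) : (unitBump : 𝔼 3 → ℝ) w = 0 :=
  unitBump.zero_of_le_dist (by simpa [unitBump] using hw)

/-- The bump takes values in `[0, 1]`. [folklore] -/
theorem unitBump_mem_Icc (w : 𝔼 3) : (unitBump : 𝔼 3 → ℝ) w ∈ Icc (0 : ℝ) 1 :=
  ⟨unitBump.nonneg, unitBump.le_one⟩

/-- The bump is smooth. [folklore] -/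
theorem contDiff_unitBump : ContDiff ℝ ∞ (unitBump : 𝔼 3 → ℝ) := unitBump.contDiff

end Bump

namespace AmbientIsotopy

variable (F : AmbientIsotopy (𝓡 1) (𝕊 1))

/-- The stage `F_t` is recovered from the inverse of the track: `F_t ((track⁻¹ (t, y)).2) = y`. [folklore] -/
theorem toFun_trackDiffeomorph_symm_snd (t : ℝ) (y : 𝕊 1) :
    F.toFun t (F.trackDiffeomorph.symm (t, y)).2 = y := by
  have h := F.trackDiffeomorph.apply_symm_apply (t, y)
  rw [coe_trackDiffeomorph] at h
  have h1 : (F.trackDiffeomorph.symm (t, y)).1 = t := congrArg Prod.fst h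
  have h2 := congrArg Prod.snd h
  simp only [trackFun] at h2
  rw [h1] at h2
  exact h2

/-- The inverse of the track undoes the stages: `(track⁻¹ (t, F_t x)).2 = x`. [folklore] -/
theorem trackDiffeomorph_symm_snd_toFun (t : ℝ) (x : 𝕊 1) :
    (F.trackDiffeomorph.symm (t, F.toFun t x)).2 = x := by
  have h : F.trackDiffeomorph.symm (t, F.toFun t x) = (t, x) := by
    rw [← F.trackFun_apply, ← coe_trackDiffeomorph, Diffeomorph.symm_apply_apply]
  rw [h]

/-- The slide of an ambient isotopy of the circle, cut off in the fibre: `(u, w) ↦ (F_{b(w)} u, w)`. [folklore] -/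
def slideFun (p : (𝕊 1) × 𝔼 3) : (𝕊 1) × 𝔼 3 := (F.toFun ((unitBump : 𝔼 3 → ℝ) p.2) p.1, p.2)

/-- The inverse slide `(u, w) ↦ (F_{b(w)}⁻¹ u, w)`, through the inverse of the track of `F`. [folklore] -/
def slideInv (p : (𝕊 1) × 𝔼 3) : (𝕊 1) × 𝔼 3 :=
  ((F.trackDiffeomorph.symm ((unitBump : 𝔼 3 → ℝ) p.2, p.1)).2, p.2)

/-- The slide is smooth. [folklore] -/
theorem contMDiff_slideFun : ContMDiff ((𝓡 1).prod 𝓘(ℝ, 𝔼 3)) ((𝓡 1).prod 𝓘(ℝ, 𝔼 3)) ∞ F.slideFun := by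
  have hb : ContMDiff ((𝓡 1).prod 𝓘(ℝ, 𝔼 3)) 𝓘(ℝ, ℝ) ∞ fun p : (𝕊 1) × 𝔼 3 ↦ (unitBump : 𝔼 3 → ℝ) p.2 :=
    contDiff_unitBump.contMDiff.comp contMDiff_snd
  have h1 : ContMDiff ((𝓡 1).prod 𝓘(ℝ, 𝔼 3)) (𝓘(ℝ, ℝ).prod (𝓡 1)) ∞
      fun p : (𝕊 1) × 𝔼 3 ↦ ((unitBump : 𝔼 3 → ℝ) p.2, p.1) := hb.prodMk contMDiff_fst
  exact (F.contMDiff.comp h1).prodMk contMDiff_snd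

/-- The inverse slide is smooth. [folklore] -/
theorem contMDiff_slideInv : ContMDiff ((𝓡 1).prod 𝓘(ℝ, 𝔼 3)) ((𝓡 1).prod 𝓘(ℝ, 𝔼 3)) ∞ F.slideInv := by
  have hb : ContMDiff ((𝓡 1).prod 𝓘(ℝ, 𝔼 3)) 𝓘(ℝ, ℝ) ∞ fun p : (𝕊 1) × 𝔼 3 ↦ (unitBump : 𝔼 3 → ℝ) p.2 :=
    contDiff_unitBump.contMDiff.comp contMDiff_snd
  have h1 : ContMDiff ((𝓡 1).prod 𝓘(ℝ, 𝔼 3)) (𝓘(ℝ, ℝ).prod (𝓡 1)) ∞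
      fun p : (𝕊 1) × 𝔼 3 ↦ ((unitBump : 𝔼 3 → ℝ) p.2, p.1) := hb.prodMk contMDiff_fst
  exact (contMDiff_snd.comp (F.trackDiffeomorph.symm.contMDiff.comp h1)).prodMk contMDiff_snd

/-- **The slide of an ambient isotopy `F` of `𝕊¹`**, cut off by the bump `unitBump` in the fibre:
the diffeomorphism `(u, w) ↦ (F_{b(w)} u, w)` of `𝕊¹ × ℝ³`, the identity off the unit ball bundle
(`b = 0` there and `F₀ = id`), with `S (u, 0) = (F₁ u, 0)`. [cite: GompfStipsiczGSM1999, §5.2] -/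
def tubeSlide : TubeSlide where
  toDiffeomorph :=
    { toFun := F.slideFun
      invFun := F.slideInv
      left_inv := fun p ↦ Prod.ext (F.trackDiffeomorph_symm_snd_toFun _ _) rfl
      right_inv := fun p ↦ Prod.ext (F.toFun_trackDiffeomorph_symm_snd _ _) rfl
      contMDiff_toFun := F.contMDiff_slideFun
      contMDiff_invFun := F.contMDiff_slideInv }
  radius := 1
  eq_self p hp := by
    show F.slideFun p = p
    refine Prod.ext ?_ rfl
    show F.toFun ((unitBump : 𝔼 3 → ℝ) p.2) p.1 = p.1
    rw [unitBump_of_one_le hp, F.map_zero, id]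

/-- The slide, pointwise (definitional). [folklore] -/
@[simp] theorem tubeSlide_apply (p : (𝕊 1) × 𝔼 3) :
    F.tubeSlide.toDiffeomorph p = (F.toFun ((unitBump : 𝔼 3 → ℝ) p.2) p.1, p.2) := rfl

/-- On the zero section the slide is the final stage `F₁`. [folklore] -/
theorem tubeSlide_apply_zero (u : 𝕊 1) : F.tubeSlide.toDiffeomorph (u, 0) = (F.toFun 1 u, 0) := by
  rw [tubeSlide_apply, unitBump_apply_zero]

end AmbientIsotopy

/-! ### Base reparametrisations from families of positive lifts -/

section LiftTube

variable {Φ : 𝔼 3 → ℝ → ℝ} (hs : ContDiff ℝ ∞ fun q : (𝔼 3) × ℝ ↦ Φ q.1 q.2)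
  (hpos : ∀ w, IsPosLift (Φ w))

/-- **The track `(w, θ) ↦ (w, Φ_w θ)` of a smooth family of positive lifts**, a diffeomorphism of
`ℝ³ × ℝ` (fibrewise inverse function theorem, `fibrewiseDiffeomorph`). [folklore] -/
def liftTrack : ((𝔼 3) × ℝ) ≃ₘ⟮𝓘(ℝ, 𝔼 3).prod 𝓘(ℝ, ℝ), 𝓘(ℝ, 𝔼 3).prod 𝓘(ℝ, ℝ)⟯ ((𝔼 3) × ℝ) :=
  fibrewiseDiffeomorph (J := 𝓘(ℝ, 𝔼 3)) (F := Φ) (contMDiff_prodModel_of_contDiff hs)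
    (fun w ↦ (hpos w).isLocalDiffeomorph) (fun w ↦ (hpos w).bijective)

/-- The track, pointwise. [folklore] -/
@[simp] theorem liftTrack_apply (q : (𝔼 3) × ℝ) : liftTrack hs hpos q = (q.1, Φ q.1 q.2) := rfl

/-- **The inverse lifts** `Φ_w⁻¹`, read off from the inverse of the track (hence jointly smooth). [folklore] -/
def liftInv (w : 𝔼 3) (y : ℝ) : ℝ := ((liftTrack hs hpos).symm (w, y)).2

/-- The inverse lifts are the inverses `(hpos w).inv` of the positive lifts. [folklore] -/
theorem liftInv_eq (w : 𝔼 3) : liftInv hs hpos w = (hpos w).inv := by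
  funext y
  have h := (liftTrack hs hpos).apply_symm_apply (w, y)
  rw [liftTrack_apply] at h
  have h1 : ((liftTrack hs hpos).symm (w, y)).1 = w := congrArg Prod.fst h
  have h2 : Φ ((liftTrack hs hpos).symm (w, y)).1 ((liftTrack hs hpos).symm (w, y)).2 = y :=
    congrArg Prod.snd h
  rw [h1] at h2
  apply (hpos w).injective
  rw [(hpos w).apply_inv]
  exact h2

/-- The inverse lifts are jointly smooth. [folklore] -/
theorem contDiff_liftInv : ContDiff ℝ ∞ fun q : (𝔼 3) × ℝ ↦ liftInv hs hpos q.1 q.2 :=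
  contDiff_of_contMDiff_prodModel (contMDiff_snd.comp (liftTrack hs hpos).symm.contMDiff)

/-- The inverse lifts commute with the deck translation. [folklore] -/
theorem liftInv_add_two_pi (w : 𝔼 3) (y : ℝ) :
    liftInv hs hpos w (y + 2 * π) = liftInv hs hpos w y + 2 * π := by
  rw [liftInv_eq]
  exact (hpos w).inv_add_two_pi y

include hs in
/-- The inverse lifts as a jointly smooth function (for use through `liftTubeDiffeo_symm_apply`). [folklore] -/
theorem contDiff_inv_family : ContDiff ℝ ∞ fun q : (𝔼 3) × ℝ ↦ (hpos q.1).inv q.2 := by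
  have h : (fun q : (𝔼 3) × ℝ ↦ (hpos q.1).inv q.2) = fun q ↦ liftInv hs hpos q.1 q.2 := by
    funext q
    rw [liftInv_eq]
  rw [h]
  exact contDiff_liftInv hs hpos

variable {r : ℝ} (hr : ∀ w : 𝔼 3, r ≤ ‖w‖ → ∀ θ, Φ w θ = θ) (h0 : ∀ θ, Φ 0 θ = θ)
include hr h0

/-- **The base reparametrisation of a family of positive lifts**: the `TubeDiffeo`
`(u, w) ↦ (circleDescend (Φ w) u, w)` of `𝕊¹ × ℝ³` — over the fibre parameter `w` the circle is
reparametrised by the degree-one diffeomorphism with lift `Φ w`; it fixes the zero section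
(`Φ 0 = id`) and is the identity for `‖w‖ ≥ r` (`Φ w = id` there). [cite: GompfStipsiczGSM1999, §5.2] -/
def liftTubeDiffeo : TubeDiffeo where
  toDiffeomorph :=
    { toFun := fun p ↦ (circleDescend (Φ p.2) p.1, p.2)
      invFun := fun p ↦ (circleDescend (liftInv hs hpos p.2) p.1, p.2)
      left_inv := fun p ↦ by
        refine Prod.ext ?_ rfl
        show circleDescend (liftInv hs hpos p.2) (circleDescend (Φ p.2) p.1) = p.1
        rw [liftInv_eq]
        exact (hpos p.2).toDiffeomorph.symm_apply_apply p.1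
      right_inv := fun p ↦ by
        refine Prod.ext ?_ rfl
        show circleDescend (Φ p.2) (circleDescend (liftInv hs hpos p.2) p.1) = p.1
        rw [liftInv_eq]
        exact (hpos p.2).toDiffeomorph.apply_symm_apply p.1
      contMDiff_toFun :=
        (contMDiff_circleDescend_family (fun w ↦ (hpos w).add_two_pi) hs).prodMk contMDiff_snd
      contMDiff_invFun :=
        (contMDiff_circleDescend_family (liftInv_add_two_pi hs hpos)
          (contDiff_liftInv hs hpos)).prodMk contMDiff_snd }
  radius := r
  apply_zero u := by
    refine Prod.ext ?_ rfl
    show circleDescend (Φ 0) u = u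
    have : Φ 0 = fun θ ↦ θ := funext h0
    rw [this, circleDescend_id, id]
  eq_self p hp := by
    refine Prod.ext ?_ rfl
    show circleDescend (Φ p.2) p.1 = p.1
    have : Φ p.2 = fun θ ↦ θ := funext (hr p.2 hp)
    rw [this, circleDescend_id, id]

/-- The base reparametrisation, pointwise (definitional). [folklore] -/
@[simp] theorem liftTubeDiffeo_apply (p : (𝕊 1) × 𝔼 3) :
    (liftTubeDiffeo hs hpos hr h0).toDiffeomorph p = (circleDescend (Φ p.2) p.1, p.2) := rfl

/-- The base reparametrisation over an angle: `(circlePoint θ, w) ↦ (circlePoint (Φ_w θ), w)`. [folklore] -/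
theorem liftTubeDiffeo_apply_circlePoint (θ : ℝ) (w : 𝔼 3) :
    (liftTubeDiffeo hs hpos hr h0).toDiffeomorph (circlePoint θ, w) = (circlePoint (Φ w θ), w) := by
  rw [liftTubeDiffeo_apply, circleDescend_circlePoint (hpos w).add_two_pi]

/-- The inverse base reparametrisation, pointwise. [folklore] -/
theorem liftTubeDiffeo_symm_apply (p : (𝕊 1) × 𝔼 3) :
    (liftTubeDiffeo hs hpos hr h0).toDiffeomorph.symm p = (circleDescend (hpos p.2).inv p.1, p.2) := by
  show (circleDescend (liftInv hs hpos p.2) p.1, p.2) = _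
  rw [liftInv_eq]

/-- The inverse base reparametrisation over an angle. [folklore] -/
theorem liftTubeDiffeo_symm_apply_circlePoint (θ : ℝ) (w : 𝔼 3) :
    (liftTubeDiffeo hs hpos hr h0).toDiffeomorph.symm (circlePoint θ, w) =
      (circlePoint ((hpos w).inv θ), w) := by
  rw [liftTubeDiffeo_symm_apply, circleDescend_circlePoint (hpos w).isPosLift_inv.add_two_pi]

end LiftTube

end Literature.Topology.FourManifolds
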